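import Summits.KontsevichZagierPeriods.KontsevichZagierPeriods.Theorems.ValuedFieldSpecialisationCTConstructionBlowupShear
import Summits.KontsevichZagierPeriods.KontsevichZagierPeriods.Theorems.ValuedFieldSpecialisationCTConstructionBlowupRecast
import Summits.KontsevichZagierPeriods.KontsevichZagierPeriods.Theorems.ValuedFieldSpecialisationCTConstructionBlowupExpansion
import Summits.KontsevichZagierPeriods.KontsevichZagierPeriods.Theorems.ValuedFieldSpecialisationCTConstructionBlowupSorted
import Summits.KontsevichZagierPeriods.KontsevichZagierPeriods.Theorems.ValuedFieldSpecialisationCTConstructionBlowupFibreRep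
import Summits.KontsevichZagierPeriods.KontsevichZagierPeriods.Theorems.ValuedFieldSpecialisationCTConstructionDilateMap
import Summits.KontsevichZagierPeriods.KontsevichZagierPeriods.Theorems.ValuedFieldSpecialisationCTConstructionCylinderMoments
import Summits.KontsevichZagierPeriods.KontsevichZagierPeriods.Theorems.ValuedFieldSpecialisationParametricLiftingElementaryNetFibred
import Mathlib.Data.Nat.Choose.Sum

/-!
# Route ValuedFieldSpecialisation — crux `CTConstruction`: the binomial law of the blow-up

Helper toward crux stmt-KontsevichZagierPeriods-3495 (`CTConstruction`), line `registered`, reshape r4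
(blow-up elimination of the log block; lead file). Assembly of the wave-1 worker stubs into the
**binomial law**: for an elementary divergent product `P = P(p, q, B, d, r)` with `p < q` and any map
`Tβ` on generators of `KZ.FormalRep` sending a family to the class of its weight-slab BLOW-UP (domain
`{0 < t < σ < 1, (t, x) ∈ P.domain}`, integrand `(t/σ²) · P.integrand (t, x)`), one has, modulo
FIBRED relations,

  `FreeAbelianGroup.lift Tβ [P] ≡ Σ_{n = 0}^{B} (B choose n) • [P'ₙ]`,

where `P'ₙ` is the elementary divergent product with data `(p, q, B − n)` over the FIBRE
REPRESENTATION `Wₙ = Wₙ(p, q, r)` (coordinates `(s', η₁, …, ηₙ, x)`, domain `0 < s' < 1`,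
`s' ≤ η_l ≤ 1`, `x ∈ r.domain`, integrand `s'^{1 − p/q} ∏ η_l⁻¹ r(x)`): blow up (`Tβ`), shear
`t = σ s'` (`stub_blowup_shear`), rescale the divergent coordinate by `s'^{p/q}` (`stub_blowup_recast`),
split every log coordinate at `t_j = σ` (`stub_blowup_split`, iterated by `stub_blowup_expansion`), and
relabel each piece of type `S` into the elementary product over `W_{#S}` (`stub_blowup_sorted`,
`stub_exists_blowupFibreRep`; pieces with the same `#S` coincide, `KZ.IntegralRep.ext'`, and
`Finset.sum_powerset_apply_card` collects the binomial coefficients).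

Also here, for the pure-log case `p = 0`: the class of the fibre representation `W₀(0, q, r)` (the
`s'`-weighted cylinder over `r`) is `½ [r]` — `2 • [W₀] − [r] ∈ KZ.relations`
(`stub_cylinder_weighted_total` after a reindexing) — and consequently the DIAGONAL term of the
binomial law satisfies `2 • [P'₀] − [P] ∈ KZ.fibredRelations` (both sides are the fixed elementary
factor `M_{0,B}` times `W₀`, resp. `r`, `of_elementary_sub_of_prod_mem_fibredRelations`, and
`[M] * relations ⊆ fibredRelations`, `stub_productFibred`). This is the identity that makes
`T = 2 • lift Tβ − id` nilpotent on the log block.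

Sources: M. Kontsevich, D. Zagier, *Periods* (2001), §1.2 (rules (1)–(3)), §4.1 (Fubini product);
the blow-up calculus is this route's. No new definitions.
-/

noncomputable section

namespace Summit.KontsevichZagierPeriods.ValuedFieldSpecialisation

open MeasureTheory Set Filter
open scoped Topology
open Literature.NumberTheory.Transcendental Literature.NumberTheory.Transcendental.KZ

/-! ## The binomial law -/

/-- **Binomial law of the blow-up of an elementary divergent product.** See the module docstring.
The generator map `Tβ` is only assumed to send each family to the class of SOME representation with
the data of its weight-slab blow-up. [Kontsevich–Zagier 2001, §1.2] [folklore] -/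
theorem blowup_binomial {Tβ : (Σ n, IntegralRep n) → FormalRep}
    (hT : ∀ (n : ℕ) (ρ : IntegralRep (n + 1)), ∃ ρ' : IntegralRep (n + 1 + 1),
      Tβ ⟨n + 1, ρ⟩ = of ρ' ∧
      ρ'.domain = {z | 0 < z 1 ∧ z 1 < z 0 ∧ z 0 < 1 ∧ (fun i : Fin (n + 1) => z i.succ) ∈ ρ.domain} ∧
      ρ'.integrand = fun z => z 1 / z 0 ^ 2 * ρ.integrand (fun i : Fin (n + 1) => z i.succ))
    {p q B d : ℕ} (hpq : p < q) (r : IntegralRep d) (P : IntegralRep (B + d + 1 + 1))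
    (hPd : P.domain = {z | ∃ (s u : ℝ) (y : Fin B → ℝ) (w : Fin d → ℝ),
      z = Matrix.vecCons s (Matrix.vecCons u (Fin.append y w)) ∧ 0 < s ∧ s < 1 ∧ 0 < u ∧
        u ^ q * s ^ p < 1 ∧ (∀ j, s ≤ y j ∧ y j ≤ 1) ∧ w ∈ r.domain})
    (hPi : P.integrand = fun z => (∏ j : Fin B, (z (Fin.castAdd d j).succ.succ)⁻¹) *
      r.integrand (fun l : Fin d => z (Fin.natAdd B l).succ.succ)) :
    ∃ (W : (n : ℕ) → IntegralRep (n + d + 1)) (P' : (n : ℕ) → IntegralRep (B - n + (n + d + 1) + 1 + 1)),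
      (∀ n, (W n).domain = {v | ∃ (s' : ℝ) (η : Fin n → ℝ) (x : Fin d → ℝ),
          v = Matrix.vecCons s' (Fin.append η x) ∧ 0 < s' ∧ s' < 1 ∧ (∀ l, s' ≤ η l ∧ η l ≤ 1) ∧
            x ∈ r.domain} ∧
        (W n).integrand = fun v => v 0 ^ ((1 - (p : ℚ) / q : ℚ) : ℝ) *
          ((∏ l : Fin n, (v (Fin.castAdd d l).succ)⁻¹) * r.integrand (fun i : Fin d => v (Fin.natAdd n i).succ))) ∧
      (∀ n, (P' n).domain = {z | ∃ (s u : ℝ) (y : Fin (B - n) → ℝ) (w : Fin (n + d + 1) → ℝ),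
          z = Matrix.vecCons s (Matrix.vecCons u (Fin.append y w)) ∧ 0 < s ∧ s < 1 ∧ 0 < u ∧
            u ^ q * s ^ p < 1 ∧ (∀ j, s ≤ y j ∧ y j ≤ 1) ∧ w ∈ (W n).domain} ∧
        (P' n).integrand = fun z => (∏ j : Fin (B - n), (z (Fin.castAdd (n + d + 1) j).succ.succ)⁻¹) *
          (W n).integrand (fun l : Fin (n + d + 1) => z (Fin.natAdd (B - n) l).succ.succ)) ∧
      FreeAbelianGroup.lift Tβ (of P) - ∑ n ∈ Finset.range (B + 1), (B.choose n) • of (P' n) ∈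
        fibredRelations := by
  classical
  have hq : 0 < q := lt_of_le_of_lt (Nat.zero_le p) hpq
  -- blow up, shear, recast
  obtain ⟨R₀, hR₀, hR₀d, hR₀i⟩ := hT _ P
  obtain ⟨R₁, hR₁d, hR₁i, h01⟩ := stub_blowup_shear _ P R₀ hR₀d hR₀i
  obtain ⟨F, hFd, hFi, h1F⟩ := stub_blowup_recast p q B d r P R₁ hq hPd hPi hR₁d hR₁i
  -- the fibre representations and the canonical pieces over them
  choose W hWd hWi using fun n => stub_exists_blowupFibreRep p q n d r hpq
  choose P' hP'd hP'i using fun n => exists_elementaryRep (b := B - n) hpq (W n)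
  -- expand and sort
  obtain ⟨f, hf, hFf⟩ := stub_blowup_expansion p q B d r F (stub_blowup_split p q B d r) hFd hFi
  have hsort : ∀ S : Finset (Fin B), of (f S) - of (P' S.card) ∈ fibredRelations := by
    intro S
    obtain ⟨PS, hPSd, hPSi, hrel⟩ := stub_blowup_sorted p q B d r S.card S (f S) (W S.card) rfl
      (hf S).1 (hf S).2 (hWd _) (hWi _)
    have hEq : PS = P' S.card :=
      IntegralRep.ext' (hPSd.trans (hP'd _).symm) (hPSi.trans (hP'i _).symm)
    rw [← hEq]
    exact hrel
  refine ⟨W, P', fun n => ⟨hWd n, hWi n⟩, fun n => ⟨hP'd n, hP'i n⟩, ?_⟩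
  -- collect the pieces by the number of inner coordinates
  have hcollect : ∑ S : Finset (Fin B), of (P' S.card) =
      ∑ n ∈ Finset.range (B + 1), (B.choose n) • of (P' n) := by
    have h := Finset.sum_powerset_apply_card (fun n => of (P' n)) (x := (Finset.univ : Finset (Fin B)))
    rw [Finset.powerset_univ, Finset.card_univ, Fintype.card_fin] at h
    exact h
  have hlift : FreeAbelianGroup.lift Tβ (of P) = of R₀ := by rw [dilate_lift_of, hR₀]
  have hsum : ∑ S : Finset (Fin B), of (f S) - ∑ S : Finset (Fin B), of (P' S.card) ∈ fibredRelations := by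
    rw [← Finset.sum_sub_distrib]
    exact fibredRelations.sum_mem fun S _ => hsort S
  have key : FreeAbelianGroup.lift Tβ (of P) - ∑ n ∈ Finset.range (B + 1), (B.choose n) • of (P' n) =
      (of R₀ - of R₁) + (of R₁ - of F) + (of F - ∑ S : Finset (Fin B), of (f S)) +
        (∑ S : Finset (Fin B), of (f S) - ∑ S : Finset (Fin B), of (P' S.card)) := by
    rw [hlift, ← hcollect]
    abel
  rw [key]
  exact fibredRelations.add_mem (fibredRelations.add_mem (fibredRelations.add_mem h01 h1F) hFf) hsum

/-! ## The class of the weighted cylinder `W₀`, and the diagonal term for `p = 0` -/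

/-- **The fibre representation without inner coordinates is half the base**: for `p = 0`, the
representation `W₀` (coordinates `(s', x)`, domain `0 < s' < 1`, `x ∈ r.domain`, integrand
`s' ^ 1 · r(x)`) satisfies `2 • [W₀] − [r] ∈ KZ.relations` — it is, after the relabelling
`Fin (0 + d + 1) ≃ Fin (d + 1)`, the `s`-weighted cylinder of `stub_cylinder_weighted_total`
(`∫₀¹ s ds = ½` at class level). [Kontsevich–Zagier 2001, §1.2] [folklore] -/
theorem two_nsmul_of_fibreRep_zero_sub_of_mem_relations {q d : ℕ} (r : IntegralRep d)
    (W : IntegralRep (0 + d + 1))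
    (hWd : W.domain = {v | ∃ (s' : ℝ) (η : Fin 0 → ℝ) (x : Fin d → ℝ),
      v = Matrix.vecCons s' (Fin.append η x) ∧ 0 < s' ∧ s' < 1 ∧ (∀ l, s' ≤ η l ∧ η l ≤ 1) ∧
        x ∈ r.domain})
    (hWi : W.integrand = fun v => v 0 ^ ((1 - ((0 : ℕ) : ℚ) / q : ℚ) : ℝ) *
      ((∏ l : Fin 0, (v (Fin.castAdd d l).succ)⁻¹) * r.integrand (fun i : Fin d => v (Fin.natAdd 0 i).succ))) :
    2 • of W - of r ∈ relations := by
  -- relabel `Fin (0 + d + 1) ≃ Fin (d + 1)` along the identity of the underlying naturals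
  obtain ⟨e, he⟩ : ∃ e : Fin (0 + d + 1) ≃ Fin (d + 1), ∀ i, ((e i : Fin _) : ℕ) = i :=
    ⟨finCongr (by omega), fun i => rfl⟩
  have he0 : e 0 = 0 := Fin.ext (by rw [he]; rfl)
  have hes : ∀ i : Fin d, e (Fin.natAdd 0 i).succ = i.succ := fun i =>
    Fin.ext (by rw [he]; simp)
  set C : IntegralRep (d + 1) := W.reindex e with hC
  have hexp : (((1 - ((0 : ℕ) : ℚ) / q : ℚ)) : ℝ) = 1 := by push_cast; ring
  have hCd : C.domain = r.cylinder.domain ∩ paramSlab d 0 1 := by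
    ext w
    simp only [hC, IntegralRep.reindex_domain, hWd, mem_setOf_eq, IntegralRep.domain_cylinder,
      IntegralRep.cylinderDomain, mem_inter_iff, mem_paramSlab, Rat.cast_zero, Rat.cast_one,
      IsEmpty.forall_iff, true_and]
    constructor
    · rintro ⟨s', η, x, hv, hs0, hs1, hx⟩
      have h0 : w 0 = s' := by
        have := congrFun hv 0
        rw [he0] at this
        simpa using this
      have hx' : (fun i : Fin d => w i.succ) = x := by
        funext i
        have := congrFun hv (Fin.natAdd 0 i).succ
        rw [hes] at this
        rw [this]
        simp [Matrix.vecCons, Fin.append, Fin.addCases, Fin.cons]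
      rw [h0, hx']
      exact ⟨⟨hs0, hs1, hx⟩, hs0, hs1⟩
    · rintro ⟨⟨hs0, hs1, hx⟩, -, -⟩
      refine ⟨w 0, Fin.elim0, fun i => w i.succ, ?_, hs0, hs1, hx⟩
      funext i
      rcases Fin.eq_zero_or_eq_succ (e i) with h | ⟨j, hj⟩
      · have hi : i = 0 := e.injective (h.trans he0.symm)
        subst hi
        rw [he0]
        rfl
      · have hi : i = (Fin.natAdd 0 j).succ := e.injective (hj.trans (hes j).symm)
        subst hi
        rw [hes]
        simp [Matrix.vecCons, Fin.append, Fin.addCases, Fin.cons]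
  have hCi : C.integrand = fun z => z 0 ^ 1 * r.cylinder.integrand z := by
    funext z
    simp only [hC, IntegralRep.reindex_integrand, hWi, he0, hes, hexp, Real.rpow_one, pow_one,
      Finset.univ_eq_empty, Finset.prod_empty, one_mul, IntegralRep.integrand_cylinder]
  have h1 : 2 • of C - of r ∈ relations := stub_cylinder_weighted_total d r C hCd hCi
  have h2 : of W - of C ∈ relations := of_sub_of_reindex_mem_relations W e
  have : 2 • of W - of r = 2 • (of W - of C) + (2 • of C - of r) := by abel
  rw [this]
  exact relations.add_mem (relations.nsmul_mem h2 2) h1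

/-- **The diagonal term of the binomial law is half the family (pure-log case).** If `P` is the
elementary divergent product with data `(0, q, b)` over `r`, `P'` the one with data `(0, q', b')`,
`b' = b`, over a representation `W` with `2 • [W] − [r] ∈ KZ.relations`, then
`2 • [P'] − [P] ∈ KZ.fibredRelations`: both are fibred-equivalent to the Fubini product of the FIXED
elementary factor `M = M(0, 1, b)` over the unit representation with `W`, resp. `r`
(`of_elementary_sub_of_prod_mem_fibredRelations`), and `[M] * (2 • [W] − [r])` is a fibred relation
(`stub_productFibred`). [Kontsevich–Zagier 2001, §1.2, §4.1] [folklore] -/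
theorem two_nsmul_of_sub_of_mem_fibredRelations_of_diag {q q' b b' d d' : ℕ} (hq : 0 < q) (hq' : 0 < q')
    (hb : b' = b) (r : IntegralRep d) (W : IntegralRep d') (P : IntegralRep (b + d + 1 + 1))
    (P' : IntegralRep (b' + d' + 1 + 1))
    (hPd : P.domain = {z | ∃ (s u : ℝ) (y : Fin b → ℝ) (w : Fin d → ℝ),
      z = Matrix.vecCons s (Matrix.vecCons u (Fin.append y w)) ∧ 0 < s ∧ s < 1 ∧ 0 < u ∧
        u ^ q * s ^ 0 < 1 ∧ (∀ j, s ≤ y j ∧ y j ≤ 1) ∧ w ∈ r.domain})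
    (hPi : P.integrand = fun z => (∏ j : Fin b, (z (Fin.castAdd d j).succ.succ)⁻¹) *
      r.integrand (fun l : Fin d => z (Fin.natAdd b l).succ.succ))
    (hP'd : P'.domain = {z | ∃ (s u : ℝ) (y : Fin b' → ℝ) (w : Fin d' → ℝ),
      z = Matrix.vecCons s (Matrix.vecCons u (Fin.append y w)) ∧ 0 < s ∧ s < 1 ∧ 0 < u ∧
        u ^ q' * s ^ 0 < 1 ∧ (∀ j, s ≤ y j ∧ y j ≤ 1) ∧ w ∈ W.domain})
    (hP'i : P'.integrand = fun z => (∏ j : Fin b', (z (Fin.castAdd d' j).succ.succ)⁻¹) *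
      W.integrand (fun l : Fin d' => z (Fin.natAdd b' l).succ.succ))
    (hW : 2 • of W - of r ∈ relations) :
    2 • of P' - of P ∈ fibredRelations := by
  obtain ⟨M, hMd, hMi⟩ := exists_elementaryRep (p := 0) (q := 1) (b := b) Nat.zero_lt_one IntegralRep.unit
  have h1 : of P - of (M.prod r) ∈ fibredRelations :=
    of_elementary_sub_of_prod_mem_fibredRelations hq Nat.zero_lt_one (by simp) rfl r P M hPd hPi hMd hMi
  have h2 : of P' - of (M.prod W) ∈ fibredRelations :=
    of_elementary_sub_of_prod_mem_fibredRelations hq' Nat.zero_lt_one (by simp) hb W P' M hP'd hP'i hMd hMi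
  have h3 : of M * (2 • of W - of r) ∈ fibredRelations :=
    LiouvilleUnfolding.SpectatorLocalisation.stub_productFibred _ M (by omega) _ hW
  have h3' : of M * (2 • of W - of r) = 2 • of (M.prod W) - of (M.prod r) := by
    rw [mul_sub, two_nsmul, two_nsmul, mul_add, of_mul_of, of_mul_of]
  rw [h3'] at h3
  have : 2 • of P' - of P = 2 • (of P' - of (M.prod W)) - (of P - of (M.prod r)) +
      (2 • of (M.prod W) - of (M.prod r)) := by abel
  rw [this]
  exact fibredRelations.add_mem (fibredRelations.sub_mem (fibredRelations.nsmul_mem h2 2) h1) h3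

/-- **Registered stub `stub_blowup_binomial`** (crux `CTConstruction`, line `registered`, reshape r4):
the binomial law of the blow-up, explicit form of `blowup_binomial`. [folklore] -/
theorem stub_blowup_binomial : ∀ (Tβ : (Σ n, Literature.NumberTheory.Transcendental.KZ.IntegralRep n) → Literature.NumberTheory.Transcendental.KZ.FormalRep), (∀ (n : ℕ) (ρ : Literature.NumberTheory.Transcendental.KZ.IntegralRep (n + 1)), ∃ ρ' : Literature.NumberTheory.Transcendental.KZ.IntegralRep (n + 1 + 1), Tβ ⟨n + 1, ρ⟩ = Literature.NumberTheory.Transcendental.KZ.of ρ' ∧ ρ'.domain = {z | 0 < z 1 ∧ z 1 < z 0 ∧ z 0 < 1 ∧ (fun i : Fin (n + 1) => z i.succ) ∈ ρ.domain} ∧ ρ'.integrand = fun z => z 1 / z 0 ^ 2 * ρ.integrand (fun i : Fin (n + 1) => z i.succ)) → ∀ (p q B d : ℕ), p < q → ∀ (r : Literature.NumberTheory.Transcendental.KZ.IntegralRep d) (P : Literature.NumberTheory.Transcendental.KZ.IntegralRep (B + d + 1 + 1)), P.domain = {z | ∃ (s u : ℝ) (y : Fin B → ℝ) (w : Fin d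 → ℝ), z = Matrix.vecCons s (Matrix.vecCons u (Fin.append y w)) ∧ 0 < s ∧ s < 1 ∧ 0 < u ∧ u ^ q * s ^ p < 1 ∧ (∀ j, s ≤ y j ∧ y j ≤ 1) ∧ w ∈ r.domain} → P.integrand = (fun z => (∏ j : Fin B, (z (Fin.castAdd d j).succ.succ)⁻¹) * r.integrand (fun l : Fin d => z (Fin.natAdd B l).succ.succ)) → ∃ (W : (n : ℕ) → Literature.NumberTheory.Transcendental.KZ.IntegralRep (n + d + 1)) (P' : (n : ℕ) → Literature.NumberTheory.Transcendental.KZ.IntegralRep (B - n + (n + d + 1) + 1 + 1)), (∀ n, (W n).domain = {v | ∃ (s' : ℝ) (η : Fin n → ℝ) (x : Fin d → ℝ), v = Matrix.vecCons s' (Fin.append η x) ∧ 0 < s' ∧ s' < 1 ∧ (∀ l, s' ≤ η l ∧ η l ≤ 1) ∧ x ∈ r.domain} ∧ (W n).integrand = fun v => v 0 ^ ((1 - (p : ℚ) / q : ℚ) : ℝ) * ((∏ l : Fin n, (v (Fin.castAdd d l).succ)⁻¹) * r.integrand (fun i : Fin d => v (Fin.natAdd n i).succ))) ∧ (∀ n,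 (P' n).domain = {z | ∃ (s u : ℝ) (y : Fin (B - n) → ℝ) (w : Fin (n + d + 1) → ℝ), z = Matrix.vecCons s (Matrix.vecCons u (Fin.append y w)) ∧ 0 < s ∧ s < 1 ∧ 0 < u ∧ u ^ q * s ^ p < 1 ∧ (∀ j, s ≤ y j ∧ y j ≤ 1) ∧ w ∈ (W n).domain} ∧ (P' n).integrand = fun z => (∏ j : Fin (B - n), (z (Fin.castAdd (n + d + 1) j).succ.succ)⁻¹) * (W n).integrand (fun l : Fin (n + d + 1) => z (Fin.natAdd (B - n) l).succ.succ)) ∧ FreeAbelianGroup.lift Tβ (Literature.NumberTheory.Transcendental.KZ.of P) - ∑ n ∈ Finset.range (B + 1), (B.choose n) • Literature.NumberTheory.Transcendental.KZ.of (P' n) ∈ Literature.NumberTheory.Transcendental.KZ.fibredRelations :=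
  fun _ hT _ _ _ _ hpq r P hPd hPi => blowup_binomial hT hpq r P hPd hPi

end Summit.KontsevichZagierPeriods.ValuedFieldSpecialisation
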